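import Summits.ABC.IUTFork.Thm311RealArchInd2Print
import HarnessLib

/-!
# [IUTchIII] Theorem 3.11 (i) (Ind2) at `v_ℚ = ∞` — the COUNT: print's factor-wise signs are FOUR distinct
# automorphisms of `K_w` at a complex place, the typed binder has TWO

Proof-only file (D-0012) of the abc-iut cell (WAVE-4 D-0067 cone-interior discharge prover, seat abc-iut-w4-d001, gen 2;
home layer L6); TAKES NO SIDE on [IUTchIII] Cor. 3.12. Companion to `Thm311RealArchInd2Print` (same seat), quantifying
finding F-w4d001-g2-2: at a COMPLEX archimedean place `w` the four elements `1, −1, conj, −conj` of the print-literal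
(Ind2)-binder `Real.ismPrintArch logv (inl w)` ([IUTchIII] Thm. 3.11 (i) (Ind2) / Prop. 1.2 (vii): "the independent
actions of `{±1}` on each of the direct factors" of [AbsTopIII] Prop. 5.8 (v) `k~ = C~ × C~`) are pairwise DISTINCT —
`Real.ncard_ismPrintArch_of_isComplex : (ismPrintArch logv (inl w)).ncard = 4` — while abc-iut-c312-5's typed binder
`Real.ismDH (inl w) = {1, −1}` has `ncard = 2` at every archimedean place (`Real.ncard_ismDH_inl`); at a real place the
two binders coincide (`ismPrintArch_eq_ismDH_of_not_isComplex`, parent file), so `ncard = 2` there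
(`Real.ncard_ismPrintArch_of_not_isComplex`): index `[print : typed] = 2` exactly at the complex places; under
[IUTchI] Def. 3.1 (a) "`√−1 ∈ F`" that is every archimedean place. [claim: Mochizuki2012, status: disputed] for the
quotations; the arithmetic (`1 ≠ −1` in characteristic `0`, `conj ≠ 1` on `ℂ`) is classical. typed ≠ proved.
-/

noncomputable section

namespace Summit.ABC.IUTFork.Thm311.Real

open NumberField
open scoped ComplexConjugate

variable {F : Type} [Field F] [NumberField F] (logv : PadicLogs F)

/-- `1 ≠ −1` as automorphisms of `K_w` (characteristic `0`). [folklore] -/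
theorem refl_ne_neg_carrier (w : InfinitePlace F) :
    LinearEquiv.refl ℚ (Carrier (.inl w : Place F)) ≠ LinearEquiv.neg ℚ := by
  intro h
  have h1 := LinearEquiv.congr_fun h (1 : Carrier (.inl w : Place F))
  rw [LinearEquiv.refl_apply, LinearEquiv.neg_apply] at h1
  have h2 : (2 : Carrier (.inl w : Place F)) = 0 := by
    rw [← one_add_one_eq_two]
    nth_rw 2 [h1]
    exact add_neg_cancel 1
  exact two_ne_zero h2

/-- **The typed binder has exactly two elements** at every archimedean place: `ismDH (inl w) = {1, −1}`.
[claim: Mochizuki2012, status: disputed] -/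
theorem ncard_ismDH_inl (w : InfinitePlace F) : (ismDH logv (.inl w)).ncard = 2 := by
  show ({LinearEquiv.refl ℚ (Carrier (.inl w : Place F)), LinearEquiv.neg ℚ} : Set _).ncard = 2
  rw [Set.ncard_insert_of_notMem (by rw [Set.mem_singleton_iff]; exact refl_ne_neg_carrier w),
    Set.ncard_singleton]

/-- `K_w ↪ ℂ` reads `−conj` (= `conjCarrier w ≫ (−1)`) as `a ↦ −conj(a)`. [folklore] -/
theorem extensionEmbedding_conjCarrier_trans_neg (w : InfinitePlace F) (a : Carrier (.inl w : Place F)) :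
    InfinitePlace.Completion.extensionEmbedding w (((conjCarrier w).trans (LinearEquiv.neg ℚ)) a) =
      -conj (InfinitePlace.Completion.extensionEmbedding w a) := by
  rw [LinearEquiv.trans_apply, LinearEquiv.neg_apply]
  have hneg : InfinitePlace.Completion.extensionEmbedding w (-(conjCarrier w a)) =
      -InfinitePlace.Completion.extensionEmbedding w (conjCarrier w a) := map_neg _ _
  rw [← extensionEmbedding_conjCarrier w a]
  exact hneg

/-- At a complex place `−conj ≠ 1` (it sends a preimage of `1` to `−1`). [folklore] -/
theorem conjCarrier_trans_neg_ne_refl {w : InfinitePlace F} (hw : w.IsComplex) :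
    (conjCarrier w).trans (LinearEquiv.neg ℚ) ≠ LinearEquiv.refl ℚ (Carrier (.inl w : Place F)) := by
  intro h
  obtain ⟨a, ha⟩ := InfinitePlace.Completion.surjective_extensionEmbedding_of_isComplex hw 1
  have h1 := extensionEmbedding_conjCarrier_trans_neg w a
  rw [h, LinearEquiv.refl_apply] at h1
  have h2 : InfinitePlace.Completion.extensionEmbedding w a = 1 := ha
  rw [h2, map_one] at h1
  norm_num at h1

/-- At a complex place `−conj ≠ −1` (else `conj = 1`). [folklore] -/
theorem conjCarrier_trans_neg_ne_neg {w : InfinitePlace F} (hw : w.IsComplex) :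
    (conjCarrier w).trans (LinearEquiv.neg ℚ) ≠ LinearEquiv.neg ℚ (M := Carrier (.inl w : Place F)) := by
  intro h
  apply conjCarrier_ne_refl hw
  refine LinearEquiv.ext fun a => ?_
  have h1 := LinearEquiv.congr_fun h a
  rw [LinearEquiv.trans_apply, LinearEquiv.neg_apply, LinearEquiv.neg_apply] at h1
  rw [LinearEquiv.refl_apply]
  exact neg_injective h1

/-- At a complex place `−conj ≠ conj` (else `−1 = 1` on `ℂ`). [folklore] -/
theorem conjCarrier_trans_neg_ne_conjCarrier {w : InfinitePlace F} (hw : w.IsComplex) :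
    (conjCarrier w).trans (LinearEquiv.neg ℚ) ≠ conjCarrier w := by
  intro h
  obtain ⟨a, ha⟩ := InfinitePlace.Completion.surjective_extensionEmbedding_of_isComplex hw 1
  have h1 := extensionEmbedding_conjCarrier_trans_neg w a
  rw [h, extensionEmbedding_conjCarrier w a] at h1
  have h2 : InfinitePlace.Completion.extensionEmbedding w a = 1 := ha
  rw [h2, map_one] at h1
  norm_num at h1

/-- **Print's binder has exactly FOUR elements at a complex place**: `1, −1, conj, −conj` are pairwise distinct
(the Klein four-group of [AbsTopIII] Prop. 5.8 (v) factor-wise signs). [claim: Mochizuki2012, status: disputed] -/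
theorem ncard_ismPrintArch_of_isComplex {w : InfinitePlace F} (hw : w.IsComplex) :
    (ismPrintArch logv (.inl w)).ncard = 4 := by
  show ({LinearEquiv.refl ℚ (Carrier (.inl w : Place F)), LinearEquiv.neg ℚ, conjCarrier w,
    (conjCarrier w).trans (LinearEquiv.neg ℚ)} : Set _).ncard = 4
  have h1 : LinearEquiv.refl ℚ (Carrier (.inl w : Place F)) ∉
      ({LinearEquiv.neg ℚ, conjCarrier w, (conjCarrier w).trans (LinearEquiv.neg ℚ)} : Set _) := by
    simp only [Set.mem_insert_iff, Set.mem_singleton_iff, not_or]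
    exact ⟨refl_ne_neg_carrier w, (conjCarrier_ne_refl hw).symm, (conjCarrier_trans_neg_ne_refl hw).symm⟩
  have h2 : (LinearEquiv.neg ℚ : Carrier (.inl w : Place F) ≃ₗ[ℚ] _) ∉
      ({conjCarrier w, (conjCarrier w).trans (LinearEquiv.neg ℚ)} : Set _) := by
    simp only [Set.mem_insert_iff, Set.mem_singleton_iff, not_or]
    exact ⟨(conjCarrier_ne_neg hw).symm, (conjCarrier_trans_neg_ne_neg hw).symm⟩
  have h3 : conjCarrier w ∉ ({(conjCarrier w).trans (LinearEquiv.neg ℚ)} : Set _) := by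
    rw [Set.mem_singleton_iff]
    exact (conjCarrier_trans_neg_ne_conjCarrier hw).symm
  rw [Set.ncard_insert_of_notMem h1, Set.ncard_insert_of_notMem h2, Set.ncard_insert_of_notMem h3,
    Set.ncard_singleton]

/-- **At a real place print's binder has two elements** (it IS the typed one there). [claim: Mochizuki2012, status: disputed] -/
theorem ncard_ismPrintArch_of_not_isComplex {w : InfinitePlace F} (hw : ¬ w.IsComplex) :
    (ismPrintArch logv (.inl w)).ncard = 2 := by
  rw [ismPrintArch_eq_ismDH_of_not_isComplex logv hw]
  exact ncard_ismDH_inl logv w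

end Summit.ABC.IUTFork.Thm311.Real

end
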